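import Summits.ValiantsHypothesis.ValiantsHypothesis.Theorems.BarrierLeverChowThinRowsTwinPeelAll

/-!
# Route BarrierLever — item `ChowHitsThinRowPartitionMinors` (stmt-ValiantsHypothesis-20195):
# TWIN PEELING VII — the `x ↔ y` mirror of the recursion with both moves

Helper file (`--supports stmt-ValiantsHypothesis-20195`; cell valiant-natproofs, rung V4, 𝒟-side of
door (c); prover seat valiant-natproofs-prover gen 11).  Closes NO item; imports only the seat's
`…ChowThinRowsTwinPeelAll` (which transitively provides seat val-np-p4's `ChowFactor.chow_hit_swap`).

`chowHits_peelingRows_firstOrderColumns`: rows taken from a family certified by twin peeling with the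
pair move (data and hypotheses exactly as in `chowHits_firstOrderRows_of_peeling`, for the ROW family),
columns injective of size `≤ 1` — item 20195's / 20172's matrix verbatim on that slice, every height.
(The partition matrix of a product of affine forms is symmetric under exchanging the `x`- and
`y`-variables, `ChowFactor.chow_hit_swap`.)

WHAT THIS IS NOT: nothing on rows AND columns of size 2 simultaneously beyond this mirror; nothing on
items 20172 / 19717 in general, on crux stmt-ValiantsHypothesis-14610, or on `VP` versus `VNP`.
-/

set_option linter.dupNamespace false

namespace Summit.ValiantsHypothesis.ValiantsHypothesis.Theorems.BarrierLever.ChowTwinPeel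

open Finset MvPolynomial

variable {h : ℕ}

/-- **Peelable rows × first-order columns, every height**: the `x ↔ y` mirror of
`chowHits_firstOrderRows_of_peeling`. -/
theorem chowHits_peelingRows_firstOrderColumns (h p : ℕ) (𝒰s : ℕ → Finset (Finset (Fin h)))
    (cs ds : ℕ → Fin h) (pair : ℕ → Bool) (u1 u2 : ℕ → Finset (Fin h))
    (hinj : ∀ s, s < p → ∀ t, t < p → cs s = cs t → s = t)
    (hsingle : ∀ t, t < p → pair t = false →
      𝒰s (t + 1) = (𝒰s t).image (fun U => U.erase (cs t)) ∧
      (∀ U ∈ 𝒰s t, cs t ∉ U → insert (cs t) U ∈ 𝒰s t → U = u1 t))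
    (hpair : ∀ t, t < p → pair t = true →
      𝒰s (t + 1) = (𝒰s t).image (fun U => U.erase (cs t)) ∪
        ((𝒰s t).image (fun U => U.erase (cs t))).image (fun U => U.erase (ds t)) ∧
      cs t ≠ ds t ∧ ds t ∈ u1 t ∧ ds t ∉ u2 t ∧ u1 t ∈ 𝒰s t ∧ u2 t ∈ 𝒰s t ∧
      cs t ∉ u1 t ∧ cs t ∉ u2 t ∧
      (∀ U ∈ 𝒰s t, cs t ∉ U → insert (cs t) U ∈ 𝒰s t → U = u1 t ∨ U = u2 t))
    (hbudget : ((𝒰s p).biUnion Finset.powerset).card +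
      ∑ t ∈ Finset.range p, (if pair t = true then 2 else 1) ≤ h + h)
    (r : ℕ) (u w : Fin r → Finset (Fin h))
    (hu : Function.Injective u) (hw : Function.Injective w)
    (hu𝒰 : ∀ i, u i ∈ 𝒰s 0) (hw1 : ∀ j, (w j).card ≤ 1) :
    ∃ ℓ : Fin (h + h) → MvPolynomial (Fin (h + h)) ℂ, (∀ k, (ℓ k).totalDegree ≤ 1) ∧
      (Matrix.of fun i j : Fin r => MvPolynomial.coeff
        (∑ a ∈ u i, Finsupp.single (Fin.castAdd h a) 1 +
          ∑ c ∈ w j, Finsupp.single (Fin.natAdd h c) 1) (∏ k, ℓ k)).det ≠ 0 :=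
  ChowFactor.chow_hit_swap u w
    (chowHits_firstOrderRows_of_peeling h p 𝒰s cs ds pair u1 u2 hinj hsingle hpair hbudget
      r w u hw hu hw1 hu𝒰)

end Summit.ValiantsHypothesis.ValiantsHypothesis.Theorems.BarrierLever.ChowTwinPeel
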